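import Summits.Ventures.HodgeRepro.FaceCensusRows8Proof
import Summits.Ventures.HodgeRepro.FaceCensusRow12Cyclic
import Summits.Ventures.HodgeRepro.FaceCensusRow12C6C2
import Summits.Ventures.HodgeRepro.FaceCensusRow12Dihedral
import Summits.Ventures.HodgeRepro.FaceCensusRow12Dicyclic
import Summits.Ventures.HodgeRepro.Night3CensusBridge

/-!
# The sealed representatives are pairwise inequivalent under Galois twists (kernel): no double counting

Blind re-derivation cell `pub-hodge-repro`, seat `night-3` (gen 3).  Imports p4's proofs of the sealed rows (for the
sealed tables `Γ` and lists `reps`) and night-3's `Night3CensusBridge` (`twistSort`).  Namespace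
`HodgeRepro.Night3.Census`.

`repsDistinct Γ reps` is a closed `Bool` computation on the sealer's engine: for two DIFFERENT positions `a ≠ b` in
`reps`, no sorted `g_j`-twist of the corner list of `reps[b]` equals the sorted corner list of `reps[a]`.  Decided for the
eleven sealed rows, it says that the hypothesis lists `hreps` of `Night3CensusS4.lean` have no redundancy: the
1 / 3, 4, 4, 6, 5, 3 / 20, 22, 26, 20 representative corner products are pairwise NOT Galois twists of each other, so
«S4 on the sealed representatives» is S4 on exactly `reps.length` twist classes of faces — the 110 classes of the route.
(The engine-level statement only; its reading in the model is the injectivity of `finsetOf` on masks, not formalised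
here.)  Nothing here closes S4; no sealed file is touched; no Tier-2 item depends on this file.
-/

set_option autoImplicit false

namespace HodgeRepro.Night3.Census

open Summit.Ventures.HodgeRepro.FaceCensus

variable {n : ℕ}

/-- **Pairwise inequivalence** (closed `Bool` computation): for positions `a ≠ b` of `reps`, the sorted corner list of
`reps[a]` is not the sorted `g_j`-twist of the corner list of `reps[b]`, for any `j`. -/
def repsDistinct (Γ : CMGaloisType n) (reps : List (ℕ × ℕ × ℕ)) : Bool :=
  (List.finRange reps.length).all fun a => (List.finRange reps.length).all fun b =>
    a == b || (List.finRange n).all fun j =>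
      sortNat (Γ.corners (reps.getD a.val (0, 0, 0))) != twistSort Γ j (Γ.corners (reps.getD b.val (0, 0, 0)))

/-- Row `Sextic.Cyclic`: its sealed representatives are pairwise inequivalent under Galois twists. -/
theorem repsDistinct_sexticCyclic : repsDistinct Sextic.Cyclic.Γ Sextic.Cyclic.reps = true := by decide +kernel

/-- Row `Octic.Cyclic`: its sealed representatives are pairwise inequivalent under Galois twists. -/
theorem repsDistinct_octicCyclic : repsDistinct Octic.Cyclic.Γ Octic.Cyclic.reps = true := by decide +kernel

/-- Row `Octic.C4C2Square`: its sealed representatives are pairwise inequivalent under Galois twists. -/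
theorem repsDistinct_octicC4C2Square : repsDistinct Octic.C4C2Square.Γ Octic.C4C2Square.reps = true := by decide +kernel

/-- Row `Octic.C4C2Nonsquare`: its sealed representatives are pairwise inequivalent under Galois twists. -/
theorem repsDistinct_octicC4C2Nonsquare : repsDistinct Octic.C4C2Nonsquare.Γ Octic.C4C2Nonsquare.reps = true := by decide +kernel

/-- Row `Octic.Triquadratic`: its sealed representatives are pairwise inequivalent under Galois twists. -/
theorem repsDistinct_octicTriquadratic : repsDistinct Octic.Triquadratic.Γ Octic.Triquadratic.reps = true := by decide +kernel

/-- Row `Octic.Dihedral`: its sealed representatives are pairwise inequivalent under Galois twists. -/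
theorem repsDistinct_octicDihedral : repsDistinct Octic.Dihedral.Γ Octic.Dihedral.reps = true := by decide +kernel

/-- Row `Octic.Quaternion`: its sealed representatives are pairwise inequivalent under Galois twists. -/
theorem repsDistinct_octicQuaternion : repsDistinct Octic.Quaternion.Γ Octic.Quaternion.reps = true := by decide +kernel

/-- Row `Duodecic.Cyclic`: its sealed representatives are pairwise inequivalent under Galois twists. -/
theorem repsDistinct_duodecicCyclic : repsDistinct Duodecic.Cyclic.Γ Duodecic.Cyclic.reps = true := by decide +kernel

/-- Row `Duodecic.C6C2`: its sealed representatives are pairwise inequivalent under Galois twists. -/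
theorem repsDistinct_duodecicC6C2 : repsDistinct Duodecic.C6C2.Γ Duodecic.C6C2.reps = true := by decide +kernel

/-- Row `Duodecic.Dihedral`: its sealed representatives are pairwise inequivalent under Galois twists. -/
theorem repsDistinct_duodecicDihedral : repsDistinct Duodecic.Dihedral.Γ Duodecic.Dihedral.reps = true := by decide +kernel

/-- Row `Duodecic.Dicyclic`: its sealed representatives are pairwise inequivalent under Galois twists. -/
theorem repsDistinct_duodecicDicyclic : repsDistinct Duodecic.Dicyclic.Γ Duodecic.Dicyclic.reps = true := by decide +kernel

end HodgeRepro.Night3.Census
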